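import Summits.BirchSwinnertonDyer.BirchSwinnertonDyer.Theses.BiquadraticEisensteinDescent
import Literature.NumberTheory.EllipticCurves.TianYuanZhang2017.GenusPeriodsParity
import Literature.NumberTheory.EllipticCurves.Kriz2020.GoldfeldJ1728Proofs
import Literature.NumberTheory.EllipticCurves.Smith2016.CongruentNumberGenusDeterminantUnconditional
import Mathlib.NumberTheory.LegendreSymbol.JacobiSymbol

/-!
# Sketch — crux-ideate seat 2 (g5), `stmt-BirchSwinnertonDyer-21381` `HeegnerTwistCouplingInSupply`

First-lemma signatures for the crux idea card `genus-parity-short-twist`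
(Tian–Yuan–Zhang genus-parity determinism + Rédei-robust short twists on the congruent
sub-corner).  Planner sketch: nothing here is proved, nothing is filed as a statement item.
-/

open scoped Classical
open Literature.NumberTheory.EllipticCurves
open Literature.NumberTheory.EllipticCurves.TianYuanZhang2017

namespace Summit.BirchSwinnertonDyer.BirchSwinnertonDyer.Cruxes.HeegnerTwistCouplingInSupply.GenusParityShortTwist

/-- The crux, by name. -/
abbrev Crux : Prop :=
  Summit.BirchSwinnertonDyer.BirchSwinnertonDyer.Theses.BiquadraticEisensteinDescent.HeegnerTwistCouplingInSupply

/-- **First lemma (L1, the robust Rédei pattern; pure genus theory).** For primes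
`p ≡ 7, ℓ₁ ≡ 3, ℓ₂ ≡ 5 (mod 8)` with `(ℓ₁/p) = +1`, `(ℓ₂/p) = −1`, the Tian–Yuan–Zhang genus sum of
`n = p ℓ₁ ℓ₂ ≡ 1 (mod 8)` is ODD, whatever the residual symbol `(ℓ₁/ℓ₂)` is: the only admissible
decomposition is `{n}` and the Rédei matrix of `ℚ(√−n)` (disc `−4n`) has rank `3`.
(Rédei–Reichardt is in the tree: `Literature.NumberTheory.QuadraticFields.RedeiReichardtFourRank`.) -/
def RobustPairGenusSumOdd : Prop :=
  ∀ (p ℓ₁ ℓ₂ : ℕ), p.Prime → ℓ₁.Prime → ℓ₂.Prime → p % 8 = 7 → ℓ₁ % 8 = 3 → ℓ₂ % 8 = 5 →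
    jacobiSym (ℓ₁ : ℤ) p = 1 → jacobiSym (ℓ₂ : ℤ) p = -1 →
    ∀ (K : ℕ → Type) [∀ d, Field (K d)] [∀ d, NumberField (K d)],
      IsGenusFieldFamily (p * ℓ₁ * ℓ₂) K →
      Odd (genusSum₁ (p * ℓ₁ * ℓ₂) (fun d => genusClassNumber (K d)))


/-- **L1′ (the first lemma in the tree's Monsky–Smith vocabulary: a finite `𝔽₂` determinant).**
For a prime triple `q = (p, ℓ₁, ℓ₂)` with residues `(7, 3, 5) (mod 8)`, `(ℓ₁/p) = 1`, `(ℓ₂/p) = −1`,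
Smith's row-one matrix `M₁ = (A + Aᵀ, Aᵀ; A, D₂)` (Monsky's `A`, `HeathBrown1994.legendreMatrix`;
`D₂ = legendreDiagonal q 2`) has `det M₁ = 1` — for BOTH values of the free symbol `(ℓ₁/ℓ₂)`
(hand computation in NOTES.md §CARD 1; numerically 0 exceptions in 746 + 1496 + pattern tables, job
j296396).  By the UNCONDITIONAL tree theorem `Smith2016.odd_genusSum₁_iff_det_smithMatrixOne`
this is equivalent to L1 below for the tree's genus fields `GenusField d`. -/
def RobustPairSmithDetOne : Prop :=
  ∀ (q : Fin 3 → ℕ), (∀ i, (q i).Prime) → q 0 % 8 = 7 → q 1 % 8 = 3 → q 2 % 8 = 5 →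
    jacobiSym (q 1 : ℤ) (q 0) = 1 → jacobiSym (q 2 : ℤ) (q 0) = -1 →
    (Matrix.fromBlocks
        (HeathBrown1994.legendreMatrix q + (HeathBrown1994.legendreMatrix q).transpose)
        (HeathBrown1994.legendreMatrix q).transpose (HeathBrown1994.legendreMatrix q)
        (HeathBrown1994.legendreDiagonal q 2)).det = 1

/-- **Glue L1′ → L1 (statement only; it is `odd_genusSum₁_iff_det_smithMatrixOne` + `105 % 8 = 1`).** -/
def RobustPairGlue : Prop :=
  RobustPairSmithDetOne →
  ∀ (q : Fin 3 → ℕ), (∀ i, (q i).Prime) → Function.Injective q →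
    q 0 % 8 = 7 → q 1 % 8 = 3 → q 2 % 8 = 5 →
    jacobiSym (q 1 : ℤ) (q 0) = 1 → jacobiSym (q 2 : ℤ) (q 0) = -1 →
    Odd (genusSum₁ (∏ i, q i) fun d => genusClassNumber (GenusField d))

/-- **L2′ (tree form of "determinism ⇒ algebraic rank 0 and Ш[2^∞] = 0", UNCONDITIONAL in the tree via
`Smith2016.rank_zero_and_sha_iff_odd_genusSum₁`)** — the analytic statement `L(E_n,1) ≠ 0` needs in
addition only the named fact `thm11_parity_of_scriptL` (TYZ Thm 1.1) and the sign `+1` parity. -/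
def RobustPairRankZero : Prop :=
  ∀ (q : Fin 3 → ℕ) (hq : ∀ i, (q i).Prime) (hinj : Function.Injective q),
    q 0 % 8 = 7 → q 1 % 8 = 3 → q 2 % 8 = 5 →
    jacobiSym (q 1 : ℤ) (q 0) = 1 → jacobiSym (q 2 : ℤ) (q 0) = -1 →
    (haveI := isElliptic_congruentNumberCurve
        (Squarefree.ne_zero (HeathBrown1994.squarefree_prod_of_injective q hq hinj));
      (congruentNumberCurve (∏ i, q i)).mordellWeilRank = 0)

/-- **Negative structural lemma (L0, why prime twists never certify).** For `p ≡ 7 (mod 8)` and a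
prime `ℓ ≡ 7 (mod 8)` with `(ℓ/p) = −1` (the only prime Heegner twists of `E_p`), the genus sum of
`n = pℓ` is EVEN: the Heegner condition itself produces the Rédei splitting `{−ℓ, 4p}` of `ℚ(√−pℓ)`. -/
def SinglePrimeGenusSumEven : Prop :=
  ∀ (p ℓ : ℕ), p.Prime → ℓ.Prime → p % 8 = 7 → ℓ % 8 = 7 → jacobiSym (ℓ : ℤ) p = -1 →
    ∀ (K : ℕ → Type) [∀ d, Field (K d)] [∀ d, NumberField (K d)],
      IsGenusFieldFamily (p * ℓ) K →
      Even (genusSum₁ (p * ℓ) (fun d => genusClassNumber (K d)))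

/-- **L2 (determinism ⇒ non-vanishing).** Under the printed Tian–Yuan–Zhang Theorem 1.1 (tree named
fact `thm11_parity_of_scriptL`, used as a hypothesis), the robust pattern gives
`L(E_{pℓ₁ℓ₂}, 1) ≠ 0` (`𝓛(n)` odd ⇒ `𝓛(n)² ≠ 0` ⇒ analytic rank `0`, the rank-`1` branch being
excluded by the sign `+1` of `n ≡ 1 (mod 8)`). -/
def RobustPairNonvanishing : Prop :=
  thm11_parity_of_scriptL →
  ∀ (p ℓ₁ ℓ₂ : ℕ), p.Prime → ℓ₁.Prime → ℓ₂.Prime → p % 8 = 7 → ℓ₁ % 8 = 3 → ℓ₂ % 8 = 5 →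
    jacobiSym (ℓ₁ : ℤ) p = 1 → jacobiSym (ℓ₂ : ℤ) p = -1 →
    (congruentNumberCurve (p * ℓ₁ * ℓ₂)).entireLFunction 1 ≠ 0

/-- **L3 (short robust pair; the class number is free by size).** For every prime `p ≡ 7 (mod 8)`
there are primes `ℓ₁ ≡ 3`, `ℓ₂ ≡ 5 (mod 8)` with `(ℓ₁/p) = 1`, `(ℓ₂/p) = −1` and
`p ∤ h(ℚ(√−ℓ₁ℓ₂))` — witnessed by `h(−ℓ₁ℓ₂) ≤ (√(ℓ₁ℓ₂)/π)(log(4ℓ₁ℓ₂)+2) < p` as soon as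
`ℓ₁ℓ₂ < p²/(4 log² p)`: trivial under GRH (`ℓᵢ ≪ log² p`); unconditional for every `p` whose
Legendre pattern on the primes `< B` is not character-mimicking (game table, job j296396/j296620);
numerically least `ℓ₁ℓ₂ ≤ 1295` for all `p ≤ 239`. -/
def SmallRobustPairExists : Prop :=
  ∀ p : ℕ, p.Prime → p % 8 = 7 →
    ∃ ℓ₁ ℓ₂ : ℕ, ℓ₁.Prime ∧ ℓ₂.Prime ∧ ℓ₁ % 8 = 3 ∧ ℓ₂ % 8 = 5 ∧
      jacobiSym (ℓ₁ : ℤ) p = 1 ∧ jacobiSym (ℓ₂ : ℤ) p = -1 ∧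
      ∀ (K : Type) [Field K] [NumberField K], IsImaginaryQuadratic K →
        NumberField.discr K = -((ℓ₁ * ℓ₂ : ℕ) : ℤ) → ¬ p ∣ NumberField.classNumber K

/-- **Target of the line: the crux on the prime congruent sub-corner** `W = E_p : y² = x³ − p²x`,
`p ≡ 7 (mod 8)` (CM by `ℤ[i]`, `p` inert, additive at `p`, `N_W = 32p²`, analytic rank `1` by
TYZ Thm 1.2 / Monsky) — literally the conclusion of `HeegnerTwistCouplingInSupply` for these `W`,
with `K′ = ℚ(√−ℓ₁ℓ₂)` (`2` and `p` split: `−ℓ₁ℓ₂ ≡ 1 (mod 8)`, `(−ℓ₁ℓ₂/p) = 1`), and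
`W^{(d_{K′})} = E_{pℓ₁ℓ₂}` (`quadraticTwist_congruentNumberCurve`, Kriz2020/GoldfeldJ1728Proofs). -/
def CruxOnPrimeCongruentCurves : Prop :=
  ∀ (p : ℕ) [Fact p.Prime] [(congruentNumberCurve p).IsElliptic]
    [(congruentNumberCurve p).IsGloballyMinimal] [NeZero ((congruentNumberCurve p).conductorNorm ℤ)],
    p % 8 = 7 →
    ∃ (K : Type) (_ : Field K) (_ : NumberField K),
      IsImaginaryQuadratic K ∧ 4 < (NumberField.discr K).natAbs ∧
      SatisfiesHeegnerHypothesis ((congruentNumberCurve p).conductorNorm ℤ) K ∧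
      ((congruentNumberCurve p).quadraticTwist (NumberField.discr K : ℚ)).entireLFunction 1 ≠ 0 ∧
      ¬ p ∣ NumberField.classNumber K

/-- The same target for the second prime family `W = E_{2p}`, `p ≡ 3 (mod 4)` (here BOTH sign
patterns of the `(3,5)` pair are Rédei-robust, and for `p ≡ 3 (mod 8)` also `(1,−)(7,+)`). -/
def CruxOnTwicePrimeCongruentCurves : Prop :=
  ∀ (p : ℕ) [Fact p.Prime] [(congruentNumberCurve (2 * p)).IsElliptic]
    [(congruentNumberCurve (2 * p)).IsGloballyMinimal]
    [NeZero ((congruentNumberCurve (2 * p)).conductorNorm ℤ)],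
    p % 4 = 3 → (congruentNumberCurve (2 * p)).analyticRank = 1 →
    ∃ (K : Type) (_ : Field K) (_ : NumberField K),
      IsImaginaryQuadratic K ∧ 4 < (NumberField.discr K).natAbs ∧
      SatisfiesHeegnerHypothesis ((congruentNumberCurve (2 * p)).conductorNorm ℤ) K ∧
      ((congruentNumberCurve (2 * p)).quadraticTwist (NumberField.discr K : ℚ)).entireLFunction 1 ≠ 0 ∧
      ¬ p ∣ NumberField.classNumber K

/-- Shape check: the twist of `E_p` by `d = −ℓ₁ℓ₂` is the congruent curve `E_{pℓ₁ℓ₂}` (tree lemma). -/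
example (p ℓ₁ ℓ₂ : ℕ) :
    (congruentNumberCurve p).quadraticTwist ((-((ℓ₁ * ℓ₂ : ℕ) : ℤ) : ℤ) : ℚ)
      = congruentNumberCurve (p * (ℓ₁ * ℓ₂)) := by
  rw [quadraticTwist_congruentNumberCurve, Int.natAbs_neg, Int.natAbs_natCast]

end Summit.BirchSwinnertonDyer.BirchSwinnertonDyer.Cruxes.HeegnerTwistCouplingInSupply.GenusParityShortTwist
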